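import Summits.BirchSwinnertonDyer.BirchSwinnertonDyer.Theses.QuadraticBranchSignedControl
import Summits.BirchSwinnertonDyer.BirchSwinnertonDyer.Theses.InertBadSignedBranches
import Summits.BirchSwinnertonDyer.Rank1Residual.Additive.QuadraticBranchEvenLocalControl
import HarnessLib

/-!
# QuadraticBranchSignedControl — BC3 BIRTH SKELETON v2 (planner bsd-potss-plan g7/g8; stub statements keyed as `Sig.stub_<name>` so the `_of` hypotheses are the declared stubs BY NAME): per-crux stubs + proved `_of` recomposition concluding the ROUTE decl by name

Thesis X: on the quadratic branch Gss2 (`W/ℚ` additive at an odd `p` with `W^{(p*)}` good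
supersingular, `a_p = 0`, `p ≥ 5`) Kobayashi's EVEN main conjecture on the `η`-branch (C1_η),
transported to `W` through the `η`-twist Selmer dictionary (both signs), Kitajima–Otsuki's
no-finite-submodule property, the `p`-adic Gross–Zagier valuation law on the minus branch (rank 1)
and B. D. Kim's exact control with Tamagawa defect (rank 0) give `ord_p #Ш = ord_p #Ш_an` on every
Gss2 pair `p ≥ 5`; the `p = 3` share is a declared residual. `closes` targets the rung leaf
`Summit.BirchSwinnertonDyer.Rank1Residual.Additive.O5SharpGss` (D-0061 ALT-CLOSER, rung K8).
Every crux is the ∀-closure over the cell of an EXISTING typed `@[conjecture] def` node.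

REPAIR (prover leafhand-bsd-inertbadsignedbran-1-g0, 2026-08-30): byte-identical to the registered birth skeleton
735e9d0a6296a4c5 except that the two occurrences of `IsQuadraticBranchMinusLFunction` in `Sig.stub_gz_nonvanishing` /
`Sig.stub_gz_valuation` are QUALIFIED as `Additive.IsQuadraticBranchMinusLFunction` — the predicate the crux node
`Additive.QuadraticBranchMinusLeadingValuationAt` unfolds to.  Since `Kobayashi2003.IsQuadraticBranchMinusLFunction`
(Literature, body identical) landed, the unqualified name is ambiguous under this file's `open`s and the registered
file stopped elaborating (rc 1, «Ambiguous term» at l.51 / l.71).  Stub names, binder order and the `_of` composition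
are unchanged; `lean check`: rc 0, sorries 2 (= the two stubs), `pAdicGrossZagierBranch_of_stubs` concludes the crux BY NAME.
ADDED (same seat): the item is wanted by BOTH routes `QuadraticBranchSignedControl` (crux, rank 4) and `InertBadSignedBranches`
(aside, rank 9), whose route files declare `PAdicGrossZagierBranch` with IDENTICAL bodies
(`∀ W p, Additive.QuadraticBranchMinusLeadingValuationAt W p 0`); `PAdicGrossZagierBranch_inert_of` /
`pAdicGrossZagierBranch_inert_of_stubs` conclude the `InertBadSignedBranches` copy BY NAME from the same two stubs
(definitional unfolding, no new content), so one registered skeleton serves both wanting routes.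
-/

noncomputable section

open scoped Classical MatrixGroups ModularForm

open CongruenceSubgroup Field Function NumberField IsDedekindDomain WeierstrassCurve
open Literature.NumberTheory.EllipticCurves
open Literature.NumberTheory.EllipticCurves.ModularForms
open Literature.NumberTheory.EllipticCurves.Kobayashi2003
open Literature.NumberTheory.EllipticCurves.Rank1Residual
open Literature.NumberTheory.EllipticCurves.Rank1Residual.Typed
open Literature.NumberTheory.GaloisRepresentations
open Literature.NumberTheory.GaloisCohomology
open Literature.NumberTheory.EllipticCurves.IwasawaAlgebra
open Summit.BirchSwinnertonDyer.Rank1Residual Summit.BirchSwinnertonDyer.Rank1Residual.Additive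
open Summit.BirchSwinnertonDyer.BirchSwinnertonDyer.Theses.QuadraticBranchSignedControl

namespace Summit.BirchSwinnertonDyer.BirchSwinnertonDyer.Cruxes.PAdicGrossZagierBranch.Birth

/-! ### C5 `PAdicGrossZagierBranch` — non-vanishing of the linear coefficient (the signed `p`-adic
height non-degeneracy in rank one: INSIDE `PAdicHeightNondegeneracy`, declared residual) and the
valuation law given non-vanishing (the `p`-adic Gross–Zagier / BSD_p(1) computation). -/
/-- Statement of `stub_gz_nonvanishing` (keyed by the registered stub name): non-vanishing of the
linear coefficient of the minus branch `p`-adic `L`-function in analytic rank one (the signed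
`p`-adic height non-degeneracy — INSIDE `PAdicHeightNondegeneracy`, declared residual). -/
abbrev Sig.stub_gz_nonvanishing : Prop :=
  ∀ (W : WeierstrassCurve ℚ) [W.IsElliptic] [W.IsGloballyMinimal] (p : ℕ) [Fact p.Prime],
  ∀ (V : WeierstrassCurve ℚ) [V.IsElliptic] [V.IsGloballyMinimal] (C : VariableChange ℚ)
    {N : ℕ} [NeZero N] {f : CuspForm (Gamma0 N) 2},
    5 ≤ p → C • W.quadraticTwist ((-1) ^ (p / 2) * p) = V →
    V.HasGoodReductionAtPrime p → V.frobeniusTrace p = 0 → W.analyticRank = 1 →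
    IsNewformOf V f →
    ∀ (ϖ : ℚ), (if Even (p / 2) then (ϖ : ℝ) * V.realPeriodRat = plusPeriod f
        else (ϖ : ℝ) * V.imaginaryPeriodRat = minusPeriod f) →
    ∀ (L : IwasawaAlgebra p), Additive.IsQuadraticBranchMinusLFunction f p ϖ L →
    (∀ Q : (W.baseChange ℚ_[p]).toAffine.Point, p • Q = 0 → Q = 0) →
    ∀ (P : W.toAffine.Point) (n : ℕ), ¬ IsOfFinAddOrder P →
    (∀ R : W.toAffine.Point, ∃ (k : ℤ) (T : W.toAffine.Point), IsOfFinAddOrder T ∧ R = k • P + T) →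
    (∃ Q : (W.baseChange ℚ_[p]).toAffine.Point, p ^ n • Q = W.toPadicPoint p P) →
    (∀ Q : (W.baseChange ℚ_[p]).toAffine.Point, p ^ (n + 1) • Q ≠ W.toPadicPoint p P) →
    ∀ (q : ℚ), shaAn W = (q : ℂ) →
    PowerSeries.coeff 1 L ≠ 0

/-- Statement of `stub_gz_valuation`: the valuation law for the linear coefficient GIVEN its
non-vanishing (the `p`-adic Gross–Zagier / BSD_p(1) computation on the minus branch). -/
abbrev Sig.stub_gz_valuation : Prop :=
  ∀ (W : WeierstrassCurve ℚ) [W.IsElliptic] [W.IsGloballyMinimal] (p : ℕ) [Fact p.Prime],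
  ∀ (V : WeierstrassCurve ℚ) [V.IsElliptic] [V.IsGloballyMinimal] (C : VariableChange ℚ)
    {N : ℕ} [NeZero N] {f : CuspForm (Gamma0 N) 2},
    5 ≤ p → C • W.quadraticTwist ((-1) ^ (p / 2) * p) = V →
    V.HasGoodReductionAtPrime p → V.frobeniusTrace p = 0 → W.analyticRank = 1 →
    IsNewformOf V f →
    ∀ (ϖ : ℚ), (if Even (p / 2) then (ϖ : ℝ) * V.realPeriodRat = plusPeriod f
        else (ϖ : ℝ) * V.imaginaryPeriodRat = minusPeriod f) →
    ∀ (L : IwasawaAlgebra p), Additive.IsQuadraticBranchMinusLFunction f p ϖ L →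
    (∀ Q : (W.baseChange ℚ_[p]).toAffine.Point, p • Q = 0 → Q = 0) →
    ∀ (P : W.toAffine.Point) (n : ℕ), ¬ IsOfFinAddOrder P →
    (∀ R : W.toAffine.Point, ∃ (k : ℤ) (T : W.toAffine.Point), IsOfFinAddOrder T ∧ R = k • P + T) →
    (∃ Q : (W.baseChange ℚ_[p]).toAffine.Point, p ^ n • Q = W.toPadicPoint p P) →
    (∀ Q : (W.baseChange ℚ_[p]).toAffine.Point, p ^ (n + 1) • Q ≠ W.toPadicPoint p P) →
    ∀ (q : ℚ), shaAn W = (q : ℂ) →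
    PowerSeries.coeff 1 L ≠ 0 →
      ((PowerSeries.coeff 1 L : ℤ_[p]) : ℚ_[p]).valuation =
        2 * (n : ℤ) + padicValRat p (q * W.tamagawaProduct / (W.torsionOrder : ℚ) ^ 2) + 0

theorem stub_gz_nonvanishing : Sig.stub_gz_nonvanishing := by
  sorry

theorem stub_gz_valuation : Sig.stub_gz_valuation := by
  sorry

/-- Composition: the two stubs give the crux BY NAME (non-vanishing, then the valuation law). -/
theorem PAdicGrossZagierBranch_of (hnv : Sig.stub_gz_nonvanishing) (hval : Sig.stub_gz_valuation) :
    PAdicGrossZagierBranch := by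
  intro W _ _ p _ V _ _ C N _ f hp5 hCV hgood hap hr hf ϖ hϖ L hL htor P n hP hgen hdiv hndiv q hq
  have h1 := hnv W p V C hp5 hCV hgood hap hr hf ϖ hϖ L hL htor P n hP hgen hdiv hndiv q hq
  exact ⟨h1, hval W p V C hp5 hCV hgood hap hr hf ϖ hϖ L hL htor P n hP hgen hdiv hndiv q hq h1⟩

/-- The crux from the (sorried) stubs — records that the stub set is complete. -/
theorem pAdicGrossZagierBranch_of_stubs : PAdicGrossZagierBranch :=
  PAdicGrossZagierBranch_of stub_gz_nonvanishing stub_gz_valuation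

/-- Composition for the SECOND wanting route: the two stubs give the `InertBadSignedBranches` copy of the crux
BY NAME (its body is the same `∀ W p, QuadraticBranchMinusLeadingValuationAt W p 0`; definitional unfolding). -/
theorem PAdicGrossZagierBranch_inert_of (hnv : Sig.stub_gz_nonvanishing) (hval : Sig.stub_gz_valuation) :
    Summit.BirchSwinnertonDyer.BirchSwinnertonDyer.Theses.InertBadSignedBranches.PAdicGrossZagierBranch :=
  fun W _ _ p _ => PAdicGrossZagierBranch_of hnv hval W p

/-- The `InertBadSignedBranches` copy of the crux from the (sorried) stubs — records that the stub set is
complete for that route too. -/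
theorem pAdicGrossZagierBranch_inert_of_stubs :
    Summit.BirchSwinnertonDyer.BirchSwinnertonDyer.Theses.InertBadSignedBranches.PAdicGrossZagierBranch :=
  PAdicGrossZagierBranch_inert_of stub_gz_nonvanishing stub_gz_valuation

end Summit.BirchSwinnertonDyer.BirchSwinnertonDyer.Cruxes.PAdicGrossZagierBranch.Birth
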